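import Summits.HodgeConjecture.HodgeCM.Proofs.LandherrRankN_1

/-! PORT of `HodgeCM/Proofs/LandherrRankN.lean` (HodgeCMPerL run 82) — part 2: continuation of `Summits.HodgeConjecture.HodgeCM.Proofs.LandherrRankN_1` (split at a top-level declaration boundary by port_pkg.py; scope re-opened below; declarations unchanged). -/

-- port_pkg: scope re-opened for this part (file-level context, then the namespace/section stack open at the cut)
set_option autoImplicit false
noncomputable section
open NumberField
open scoped Matrix
namespace HodgeCM
open Literature.AlgebraicGeometry.ShimuraVarieties (conjRingHomK embedding_conjRingHomK)
namespace LandherrRankN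
variable (L : CMField)
section Binary
variable {L}
/-- (Ported verbatim from the HodgeCMPerL package; no docstring in the source.) -/
theorem re_ne_zero_of_isReal {x : L} (hx : conjRingHomK L x = x) (h0 : x ≠ 0) (τ : L →+* ℂ) :
    (τ x).re ≠ 0 := by
  intro h
  have e := Lemma33bLandherrProof.embedding_eq_re L hx τ
  rw [h, Complex.ofReal_zero, map_eq_zero] at e
  exact h0 e

/-- The real part at the embedding attached to the place of `τ` is the real part at `τ`. -/
theorem re_embedding_mk (τ : L →+* ℂ) (x : L) :
    ((NumberField.InfinitePlace.mk τ).embedding x).re = (τ x).re := by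
  rcases NumberField.InfinitePlace.embedding_mk_eq τ with h | h
  · rw [h]
  · rw [h, NumberField.ComplexEmbedding.conjugate_coe_eq, Complex.conj_re]

/-- Sign of `xy/z` for non-zero reals. -/
theorem pos_mul_div_iff {x y z : ℝ} (hx : x ≠ 0) (hy : y ≠ 0) (hz : z ≠ 0) :
    (0 < x * y / z) ↔ ((0 < x ↔ 0 < y) ↔ 0 < z) := by
  rcases lt_or_gt_of_ne hx with hx | hx <;> rcases lt_or_gt_of_ne hy with hy | hy <;>
    rcases lt_or_gt_of_ne hz with hz | hz
  · have h : ¬ 0 < x * y / z :=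
      not_lt.mpr (le_of_lt (div_neg_of_pos_of_neg (mul_pos_of_neg_of_neg hx hy) hz))
    simp [h, not_lt.mpr (le_of_lt hx), not_lt.mpr (le_of_lt hy), not_lt.mpr (le_of_lt hz)]
  · have h : 0 < x * y / z := div_pos (mul_pos_of_neg_of_neg hx hy) hz
    simp [h, not_lt.mpr (le_of_lt hx), not_lt.mpr (le_of_lt hy), hz]
  · have h : 0 < x * y / z := div_pos_of_neg_of_neg (mul_neg_of_neg_of_pos hx hy) hz
    simp [h, not_lt.mpr (le_of_lt hx), hy, not_lt.mpr (le_of_lt hz)]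
  · have h : ¬ 0 < x * y / z :=
      not_lt.mpr (le_of_lt (div_neg_of_neg_of_pos (mul_neg_of_neg_of_pos hx hy) hz))
    simp [h, not_lt.mpr (le_of_lt hx), hy, hz]
  · have h : 0 < x * y / z := div_pos_of_neg_of_neg (mul_neg_of_pos_of_neg hx hy) hz
    simp [h, hx, not_lt.mpr (le_of_lt hy), not_lt.mpr (le_of_lt hz)]
  · have h : ¬ 0 < x * y / z :=
      not_lt.mpr (le_of_lt (div_neg_of_neg_of_pos (mul_neg_of_pos_of_neg hx hy) hz))
    simp [h, hx, not_lt.mpr (le_of_lt hy), hz]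
  · have h : ¬ 0 < x * y / z := not_lt.mpr (le_of_lt (div_neg_of_pos_of_neg (mul_pos hx hy) hz))
    simp [h, hx, hy, not_lt.mpr (le_of_lt hz)]
  · have h : 0 < x * y / z := div_pos (mul_pos hx hy) hz
    simp [h, hx, hy, hz]

/-- The sign-multiset identity `{sgn p₁, sgn p₂} = {sgn q₁, sgn q₂}` behind the binary move. -/
theorem multiset_pair_decide_eq {p₁ p₂ q₁ q₂ : Prop} [Decidable p₁] [Decidable p₂] [Decidable q₁]
    [Decidable q₂] (h : q₁ ↔ ((p₁ ↔ p₂) ↔ q₂)) (hc : (p₁ ↔ p₂) → (q₂ ↔ p₁)) :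
    ({decide p₁, decide p₂} : Multiset Bool) = {decide q₁, decide q₂} := by
  by_cases a : p₁ <;> by_cases b : p₂ <;> by_cases c : q₂ <;> simp_all <;> decide

/-- **The binary move** (from the rank-2 theorem `lemma33bLandherr_holds`).  If `c ∈ L₀^×` has, at every
complex embedding where `b₁, b₂` have the same sign, that common sign, then `⟨b₁, b₂⟩ ≅ ⟨b₁b₂/c, c⟩`;
in particular `⟨b₁, b₂⟩` represents `c` with a diagonal complement. -/
theorem binary_move {b₁ b₂ c : L} (h₁ : conjRingHomK L b₁ = b₁) (h₂ : conjRingHomK L b₂ = b₂)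
    (hc : conjRingHomK L c = c) (h₁0 : b₁ ≠ 0) (h₂0 : b₂ ≠ 0) (hc0 : c ≠ 0)
    (hcompat : ∀ τ : L →+* ℂ, ((0 < (τ b₁).re) ↔ 0 < (τ b₂).re) → ((0 < (τ c).re) ↔ 0 < (τ b₁).re)) :
    IsomDiag L ![b₁, b₂] ![b₁ * b₂ / c, c] := by
  have hq : conjRingHomK L (b₁ * b₂ / c) = b₁ * b₂ / c := by rw [map_div₀, map_mul, h₁, h₂, hc]
  have hq0 : b₁ * b₂ / c ≠ 0 := div_ne_zero (mul_ne_zero h₁0 h₂0) hc0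
  have hre : ∀ τ : L →+* ℂ, (τ (b₁ * b₂ / c)).re = (τ b₁).re * (τ b₂).re / (τ c).re := by
    intro τ
    rw [div_eq_mul_inv, re_mul_of_isReal (by rw [map_mul, h₁, h₂]), re_mul_of_isReal h₁, re_inv_of_isReal hc,
      div_eq_mul_inv]
  obtain ⟨g, hg⟩ := lemma33bLandherr_holds L ![b₁, b₂, b₁ * b₂ / c, c]
    (by intro i; fin_cases i <;> assumption)
    (by intro i; fin_cases i <;> assumption)
    (by
      intro τ
      show ({decide (0 < (τ b₁).re), decide (0 < (τ b₂).re)} : Multiset Bool) =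
        {decide (0 < (τ (b₁ * b₂ / c)).re), decide (0 < (τ c).re)}
      refine multiset_pair_decide_eq ?_ (hcompat τ)
      rw [hre τ]
      exact pos_mul_div_iff (re_ne_zero_of_isReal h₁ h₁0 τ) (re_ne_zero_of_isReal h₂ h₂0 τ)
        (re_ne_zero_of_isReal hc hc0 τ))
    ⟨1, one_ne_zero, by
      show b₁ * b₂ = b₁ * b₂ / c * c * (1 * conjRingHomK L 1)
      rw [map_one, mul_one, mul_one, div_mul_cancel₀ _ hc0]⟩
  refine IsomDiag.of_gl g ?_
  simpa [cT] using hg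

/-- `![x, y]` over `Fin 2` versus `Sum.elim` over `Fin 1 ⊕ Fin 1`. -/
theorem vec2_comp_finSumFinEquiv (x y : L) :
    (![x, y] ∘ finSumFinEquiv : Fin 1 ⊕ Fin 1 → L) = Sum.elim (fun _ => x) (fun _ => y) := by
  ext i
  rcases i with i | i <;> · have := Subsingleton.elim i 0; subst this; rfl

/-- (Ported verbatim from the HodgeCMPerL package; no docstring in the source.) -/
theorem IsomDiag.of_vec2 {x y x' y' : L} (h : IsomDiag L ![x, y] ![x', y']) :
    IsomDiag L (Sum.elim (fun _ : Fin 1 => x) (fun _ : Fin 1 => y))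
      (Sum.elim (fun _ : Fin 1 => x') (fun _ : Fin 1 => y')) := by
  have h' := h.comp_equiv (finSumFinEquiv (m := 1) (n := 1))
  rwa [vec2_comp_finSumFinEquiv, vec2_comp_finSumFinEquiv] at h'

end Binary

/-! ## §4. The representation step: an `(n+1)`-ary diagonal form (`n ≥ 1`) represents, with a diagonal
complement, every `c ∈ L₀^×` carrying the sign of the form at each place where the form is definite -/

section Rep

variable {L}

/-- `{i // i ≠ i₀} ⊕ Fin 1 ≃ ι`, the extra point going to `i₀`. -/
def splitEquiv {ι : Type} [DecidableEq ι] (i₀ : ι) : {i // i ≠ i₀} ⊕ Fin 1 ≃ ι where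
  toFun := Sum.elim Subtype.val (fun _ => i₀)
  invFun i := if h : i = i₀ then Sum.inr 0 else Sum.inl ⟨i, h⟩
  left_inv x := by
    rcases x with ⟨i, hi⟩ | j
    · simp [hi]
    · have := Subsingleton.elim j 0
      subst this
      simp
  right_inv i := by
    by_cases h : i = i₀
    · simp [h]
    · simp [h]

/-- (Ported verbatim from the HodgeCMPerL package; no docstring in the source.) -/
@[simp] theorem splitEquiv_inl {ι : Type} [DecidableEq ι] (i₀ : ι) (k : {i // i ≠ i₀}) :
    splitEquiv i₀ (Sum.inl k) = k.1 := rfl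

/-- (Ported verbatim from the HodgeCMPerL package; no docstring in the source.) -/
@[simp] theorem splitEquiv_inr {ι : Type} [DecidableEq ι] (i₀ : ι) (j : Fin 1) :
    splitEquiv i₀ (Sum.inr j) = i₀ := rfl

/-- (Ported verbatim from the HodgeCMPerL package; no docstring in the source.) -/
theorem card_ne (ι : Type) [Fintype ι] [DecidableEq ι] (i₀ : ι) :
    Fintype.card {i // i ≠ i₀} = Fintype.card ι - 1 := by
  rw [Fintype.card_subtype_compl (fun i => i = i₀), Fintype.card_subtype_eq]

/-- `c` is compatible with the diagonal form `b`: at every complex embedding where all `bᵢ` are positive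
(resp. all negative), so is `c`.  For forms of rank `≥ 2` this is exactly "`diag b` represents `c` at every
real place". -/
def RepCompat {ι : Type} (b : ι → L) (c : L) : Prop :=
  ∀ τ : L →+* ℂ, ((∀ i, 0 < (τ (b i)).re) → 0 < (τ c).re) ∧ ((∀ i, ¬ 0 < (τ (b i)).re) → ¬ 0 < (τ c).re)

/-- **Representation with diagonal complement.**  For a non-degenerate diagonal hermitian form `b` of rank
`n + 2` (indexed by `ι ⊕ Fin 1`, `#ι = n + 1`) and a compatible `c ∈ L₀^×` there is a diagonal form `d` of
rank `n + 1` with `diag b ≅ diag d ⊥ ⟨c⟩`.  Induction on `n`, each step one binary move after a choice of signs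
by weak approximation. -/
theorem rep_step : ∀ (n : ℕ) (ι : Type) [Fintype ι] [DecidableEq ι], Fintype.card ι = n + 1 →
    ∀ (b : ι ⊕ Fin 1 → L) (c : L), (∀ x, conjRingHomK L (b x) = b x) → (∀ x, b x ≠ 0) →
    conjRingHomK L c = c → c ≠ 0 → RepCompat b c →
    ∃ d : ι → L, (∀ i, conjRingHomK L (d i) = d i) ∧ (∀ i, d i ≠ 0) ∧
      IsomDiag L b (Sum.elim d fun _ => c) := by
  intro n
  induction n with
  | zero =>
    intro ι _ _ hcard b c hb hb0 hc hc0 hcompat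
    obtain ⟨i₀, hi₀⟩ := Fintype.card_eq_one_iff.mp hcard
    -- the binary move on `(b (inl i₀), b (inr 0))`
    have hbin := binary_move (hb (Sum.inl i₀)) (hb (Sum.inr 0)) hc (hb0 _) (hb0 _) hc0 (by
      intro τ hiff
      obtain ⟨hpos, hneg⟩ := hcompat τ
      by_cases h0 : 0 < (τ (b (Sum.inl i₀))).re
      · refine iff_of_true (hpos ?_) h0
        rintro (i | j)
        · rw [hi₀ i]; exact h0
        · rw [Subsingleton.elim j 0]; exact hiff.mp h0
      · refine iff_of_false (hneg ?_) h0
        rintro (i | j)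
        · rw [hi₀ i]; exact h0
        · rw [Subsingleton.elim j 0]; exact fun h => h0 (hiff.mpr h))
    have h2 := (IsomDiag.of_vec2 hbin).comp_equiv
      (Equiv.sumCongr (Fintype.equivFinOfCardEq hcard) (Equiv.refl (Fin 1)))
    refine ⟨fun _ => b (Sum.inl i₀) * b (Sum.inr 0) / c, fun _ => by rw [map_div₀, map_mul, hb, hb, hc],
      fun _ => div_ne_zero (mul_ne_zero (hb0 _) (hb0 _)) hc0, ?_⟩
    convert h2 using 1
    · ext x
      rcases x with i | j
      · simp [hi₀ i]
      · simp [Subsingleton.elim j 0]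
    · ext x
      rcases x with i | j <;> simp
  | succ n ih =>
    intro ι _ _ hcard b c hb hb0 hc hc0 hcompat
    classical
    obtain ⟨i₀⟩ : Nonempty ι := Fintype.card_pos_iff.mp (by omega)
    -- split off `i₀`:  `ι ≃ {i // i ≠ i₀} ⊕ Fin 1`
    have hκ : Fintype.card {i // i ≠ i₀} = n + 1 := by rw [card_ne, hcard]; omega
    let eκ : {i // i ≠ i₀} ⊕ Fin 1 ≃ ι := splitEquiv i₀
    let b' : {i // i ≠ i₀} ⊕ Fin 1 → L := fun x => b (Sum.inl (eκ x))
    let bu : L := b (Sum.inr 0)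
    -- choice of the intermediate value `c'` by weak approximation (signs prescribed place by place)
    let sgnR : (L → ℝ) → Bool := fun ρ =>
      if (∀ i : ι, 0 < ρ (b (Sum.inl i)) ↔ 0 < ρ (b (Sum.inl i₀))) then decide (0 < ρ (b (Sum.inl i₀)))
      else decide (0 < ρ c)
    obtain ⟨c', hc', hc'sgn⟩ :=
      exists_isReal_signs L (fun w => sgnR fun x => (w.embedding x).re)
    have hτc' : ∀ τ : L →+* ℂ, (τ c').re ≠ 0 ∧ ((0 < (τ c').re) ↔ sgnR (fun x => (τ x).re) = true) := by
      intro τ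
      obtain ⟨r, hr, hr0, hiff⟩ := hc'sgn τ
      have hfun : (fun x => ((NumberField.InfinitePlace.mk τ).embedding x).re) = fun x => (τ x).re :=
        funext (re_embedding_mk τ)
      rw [hfun] at hiff
      rw [hr, Complex.ofReal_re]
      exact ⟨hr0, hiff⟩
    obtain ⟨τ₀⟩ : Nonempty (L →+* ℂ) := inferInstance
    have hc'0 : c' ≠ 0 := by
      intro h
      apply (hτc' τ₀).1
      rw [h, map_zero, Complex.zero_re]
    -- unfold the sign prescription
    have hsgn : ∀ τ : L →+* ℂ,
        ((∀ i : ι, 0 < (τ (b (Sum.inl i))).re ↔ 0 < (τ (b (Sum.inl i₀))).re) →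
          ((0 < (τ c').re) ↔ 0 < (τ (b (Sum.inl i₀))).re)) ∧
        (¬ (∀ i : ι, 0 < (τ (b (Sum.inl i))).re ↔ 0 < (τ (b (Sum.inl i₀))).re) →
          ((0 < (τ c').re) ↔ 0 < (τ c).re)) := by
      intro τ
      have h := (hτc' τ).2
      constructor
      · intro hall
        rw [h]
        simp only [sgnR, if_pos hall, decide_eq_true_eq]
      · intro hnall
        rw [h]
        simp only [sgnR, if_neg hnall, decide_eq_true_eq]
    -- `c'` is compatible with `b'` (whose entries are the `b (inl i)`, `i : ι`)
    have hcompat' : RepCompat b' c' := by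
      intro τ
      constructor
      · intro hall
        have hall' : ∀ i : ι, 0 < (τ (b (Sum.inl i))).re := fun i => by
          simpa [b'] using hall (eκ.symm i)
        have hiff : ∀ i : ι, 0 < (τ (b (Sum.inl i))).re ↔ 0 < (τ (b (Sum.inl i₀))).re :=
          fun i => iff_of_true (hall' i) (hall' i₀)
        exact ((hsgn τ).1 hiff).mpr (hall' i₀)
      · intro hall
        have hall' : ∀ i : ι, ¬ 0 < (τ (b (Sum.inl i))).re := fun i => by
          simpa [b'] using hall (eκ.symm i)
        have hiff : ∀ i : ι, 0 < (τ (b (Sum.inl i))).re ↔ 0 < (τ (b (Sum.inl i₀))).re :=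
          fun i => iff_of_false (hall' i) (hall' i₀)
        exact fun h => hall' i₀ (((hsgn τ).1 hiff).mp h)
    -- induction hypothesis on `κ`
    obtain ⟨d', hd', hd'0, hIH⟩ :=
      ih {i // i ≠ i₀} hκ b' c' (fun x => hb _) (fun x => hb0 _) hc' hc'0 hcompat'
    -- the binary move on `(c', bu)` with value `c`
    have hbin := binary_move hc' (hb (Sum.inr 0)) hc hc'0 (hb0 (Sum.inr 0)) hc0 (by
      intro τ hiff
      obtain ⟨hpos, hneg⟩ := hcompat τ
      by_cases hall : ∀ i : ι, 0 < (τ (b (Sum.inl i))).re ↔ 0 < (τ (b (Sum.inl i₀))).re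
      · have e1 := (hsgn τ).1 hall
        by_cases h0 : 0 < (τ (b (Sum.inl i₀))).re
        · have hc'pos : 0 < (τ c').re := e1.mpr h0
          refine iff_of_true (hpos ?_) hc'pos
          rintro (i | j)
          · exact (hall i).mpr h0
          · rw [Subsingleton.elim j 0]; exact hiff.mp hc'pos
        · have hc'neg : ¬ 0 < (τ c').re := fun h => h0 (e1.mp h)
          refine iff_of_false (hneg ?_) hc'neg
          rintro (i | j)
          · exact fun h => h0 ((hall i).mp h)
          · rw [Subsingleton.elim j 0]; exact fun h => hc'neg (hiff.mpr h)
      · exact ((hsgn τ).2 hall).symm)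
    -- assemble:  b ∘ E₂ = b' ⊥ ⟨bu⟩ ≅ (d' ⊥ ⟨c'⟩) ⊥ ⟨bu⟩ ≅ d' ⊥ ⟨c'bu/c⟩ ⊥ ⟨c⟩ = (d ⊥ ⟨c⟩) ∘ E₂
    set q : L := c' * bu / c with hq
    have h1 : IsomDiag L (Sum.elim b' fun _ : Fin 1 => bu)
        (Sum.elim (Sum.elim d' fun _ : Fin 1 => c') fun _ : Fin 1 => bu) :=
      hIH.sum (IsomDiag.refl L _)
    have h2 := ((IsomDiag.refl L d').sum (IsomDiag.of_vec2 hbin)).comp_equiv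
      (Equiv.sumAssoc {i // i ≠ i₀} (Fin 1) (Fin 1))
    have e2a : (Sum.elim d' (Sum.elim (fun _ : Fin 1 => c') fun _ : Fin 1 => bu)) ∘
        Equiv.sumAssoc {i // i ≠ i₀} (Fin 1) (Fin 1)
        = Sum.elim (Sum.elim d' fun _ : Fin 1 => c') fun _ : Fin 1 => bu := by
      ext x; rcases x with (k | j) | j <;> simp
    have e2b : (Sum.elim d' (Sum.elim (fun _ : Fin 1 => c' * bu / c) fun _ : Fin 1 => c)) ∘
        Equiv.sumAssoc {i // i ≠ i₀} (Fin 1) (Fin 1)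
        = Sum.elim (Sum.elim d' fun _ : Fin 1 => q) fun _ : Fin 1 => c := by
      ext x; rcases x with (k | j) | j <;> simp [hq]
    rw [e2a, e2b] at h2
    have h3 := h1.trans h2
    -- push forward along `E₂ : (κ ⊕ Fin 1) ⊕ Fin 1 ≃ ι ⊕ Fin 1`
    let E₂ : ({i // i ≠ i₀} ⊕ Fin 1) ⊕ Fin 1 ≃ ι ⊕ Fin 1 := Equiv.sumCongr eκ (Equiv.refl (Fin 1))
    let d : ι → L := fun i => if h : i = i₀ then q else d' ⟨i, h⟩
    refine ⟨d, fun i => ?_, fun i => ?_, IsomDiag.of_comp_equiv E₂ ?_⟩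
    · by_cases h : i = i₀
      · simp only [d, dif_pos h, hq]; rw [map_div₀, map_mul, hc', hb, hc]
      · simp only [d, dif_neg h]; exact hd' _
    · by_cases h : i = i₀
      · simp only [d, dif_pos h, hq]; exact div_ne_zero (mul_ne_zero hc'0 (hb0 _)) hc0
      · simp only [d, dif_neg h]; exact hd'0 _
    · convert h3 using 1
      · ext x
        rcases x with (k | j) | j
        · simp [E₂, b', eκ]
        · simp [E₂, b', eκ]
        · obtain rfl : j = 0 := Subsingleton.elim _ _
          simp [E₂, bu]
      · ext x
        rcases x with (⟨k, hk⟩ | j) | j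
        · simp [E₂, d, eκ, hk]
        · simp [E₂, d, eκ]
        · simp [E₂]

end Rep

/-! ## §5. Sufficiency of the invariants, by induction on the rank -/

section Main

variable {L}


-- port_pkg: scope closed for this part
end Main
end LandherrRankN
end HodgeCM
end
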